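import Literature.NumberTheory.EllipticCurves.ManinConstantClassCertificate
import HarnessLib

/-!
# The Manin constant of every optimal curve of conductor `< 500000` is `1` — Cremona's elliptic
# curve database `ecdata` (documentation `manin.txt`, data `opt_man`): the NAMED INPUT, datum grade

Topic `Literature/NumberTheory/EllipticCurves`; namespace `Literature.NumberTheory.EllipticCurves`.
Typed by the T4 MANIN typer of cell `pub/bsd-litref` (seat `bsd-litref-manin-ty`) on the ruling of
2026-08-26 (21-frontier 16:59Z «α with named dependency»; referee A ROUND 325, §325.2: "the
dependency is recorded ABOVE the class level: one CITED-FACTS row for the named decl … cited by name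
in every consuming theorem's docstring/binder — descriptive, never a tier condition"; director-bsd
17:05Z/17:10Z: "TYPE the named input now … keep theorem-grade and datum-grade as separate decls").
TWO named facts (`def … : Prop`, statements only; D-0014), both DATUM GRADE — a completed
computation asserted in the documentation of a database, NOT a refereed theorem — and proved
corollaries. Nothing is booked here; tier words are the referee's.

## The source, read (hub copy of the primary; this seat, 2026-08-26)

PRIMARY = [Cremona2022ManinConstants]: J. E. Cremona, *Manin constants and optimal curves*, the
documentation file `manin.txt` of the elliptic curve database `ecdata`
(github.com/JohnCremona/ecdata; hub copy `run/shared/lean/speedrun/kurihara/ecdata/manin.txt`,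
fetched 2026-08-18, sha256 `c40b604636bca07367d8ea247e01d8eaa82ff70165200f006d85e4211380f477`,
text "as of 26 November 2019"), with the data directory `opt_man/` (50 files, concatenation sha16
`2966cecf80927217`). Verbatim:
* ¶1: "For all conductors (levels) `N` up to `60000`, and for specific levels up to `500000`, we
  have computed the full modular symbol space for `Γ₀(N)`, and not only the plus space, in order
  to determine which curve in the isogeny class is the `Γ₀(N)`-optimal one and to determine the
  Manin constants. Note that in many cases, including isogeny classes of size 1 but only these,
  it is possible to rigorously show which curve is optimal using only the information coming from
  the plus space, and in almost all cases (see below for the exceptions) it is possible to deduce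
  that the Manin constant for the optimal curve is `1` even when there is more than one possible
  optimal curve. The justification for these claims is in the Appendix (written by me) to 'The
  Manin Constant' by Amod Agashe, Ken Ribet and William Stein [PAMQ 2 (2006) 617–636]."
* ¶2: "curve number `1` is the `Γ₀(N)`-optimal curve, with the following provisos: – in class
  `990h` the optimal curve is `990h3` […] – for `16436` conductors above `400000` (as of 26
  November 2019), the optimal curve has not yet been determined and is one of `n` curves in the
  class for some `n` between `2` and `6` inclusive. […] Of the `2164259` isogeny classes of
  conductor up to `500000`, there are `64249` of conductor `> 400000` in which the optimal curve has
  not yet been determined, and `359009` [sic] in which the optimal curve is certainly curve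
  number 1".
* ¶ "Concerning the Manin constant": "the methods described in the paper (op.cit.) have been used
  to show that the Manin constant is `1` for every optimal curve. The theoretical results on the
  Manin constant `c` which we have used are: that `c` is an integer, that `c = 2` is impossible when
  `N` is odd, and that `c = 3` is impossible unless `N` is a multiple of `3`."
* "Data files": "The data files in opt_man/ have one line for each curve where the last two fields
  contain an 'optimality code' and the Manin constant (conditional on curve number 1 being
  optimal). The optimality code is `0` for 'certainly not optimal', `1` for 'certainly optimal',
  and `n > 1` for 'one of n possibly optimal curves in its isogeny class'."
* "Additional remarks" 1: the `48` classes where the plus space alone would allow `c = 2` "I have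
  computed the full modular symbol space to eliminate the second possibility."
THIS SEAT'S CHECK OF THE DATA against the prose (hub copy, all `50` files, `2164260` classes, max
conductor `499998`): the curve-number-`1` line has optimality code `1` in `2100010` classes, code
`0` in exactly one (`990h`, where `990h3` has code `1`), code `≥ 2` in `64249` classes — the
smallest such conductor is `400002` —, and Manin-constant field `1` in EVERY class. Hence:
(R1) for every class of conductor `N ≤ 400000` the optimal curve is DETERMINED (code `1`) and its
Manin constant entry is `1`; (R2) for every class of conductor `N < 500000` the documentation
asserts `c = 1` for the optimal curve (¶1 "even when there is more than one possible optimal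
curve", ¶ "Concerning"), the optimal curve being determined exactly in the code-`1` classes.

SECONDARY (refereed statements citing the primary; recorded, not relied on for the range): Agashe–
Ribet–Stein 2006 Thm. 2.6 (`N ≤ 130000`, PRINTED THEOREM — the tree's
`AgasheRibetStein2006.cremona_abs_maninConstant_eq_one_of_level_le`); Česnavičius–Neururer–Saha 2024
§1 ("conductor `N ≤ 300000` … the full Manin [statement `c = ±1`] is known by Cremona's
verification [Cre19]" — the tree's `cremona_abs_maninConstant_eq_one_of_level_le_300000`);
Česnavičius 2018 §1 ("Cremona proved that `c_π = 1` whenever `n ≤ 390000`, see [Cre16]").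

## What is typed (datum grade), and what is NOT (theorem grade lives elsewhere, BY NAME)

* `cremona_abs_maninConstant_eq_one_of_level_le_400000` — (R1), THE DETERMINED RANGE: for every
  globally minimal `W'/ℚ`, every parametrisation datum `D'` at level `N'` with the lattice clause
  `Λ_{E'} ⊆ c·Λ_f` (so `W'` IS the optimal curve and `c = D'.maninConstant` its Manin constant —
  word for word the rendering of the two sibling facts at `130000` / `300000`), `N' ≤ 400000 →
  |c| = 1`. In this range the per-curve datum the register cites («opt_man code `1` ∧ `mc = 1`»,
  referee A R325.2 (3)) holds for EVERY class.
* `cremona_abs_maninConstant_eq_one_of_level_lt_500000` — (R2), THE FULL DATABASE RANGE: the same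
  sentence with `N' < 500000`. For the `64249` classes of conductor `> 400000` with optimality
  code `≥ 2` this transcribes the documentation's DEDUCTION "`c = 1` for the optimal curve,
  whichever of the `n` candidates it is" — a datum referee A reads as DIFFERENT from the
  code-`1` datum (R325.2 (3), R317.3 (γ″)): consumers on the «α footing» at
  `400000 < N < 500000` are the code-`1` classes only, and cite this decl TOGETHER WITH the
  register's code-`1` membership; the decl by
  itself does not say which curve is optimal (that is the hypothesis `hopt`, displayed).
* PROVED: (R2) ⇒ (R1) ⇒ the `300000` sibling ⇒ the `130000` printed theorem (one sentence at four
  bounds, four tier words); the binder shapes `¬ (p : ℤ) ∣ D'.maninConstant` /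
  `padicValInt p D'.maninConstant = 0` (the census's H-TAB-MANIN hypothesis «`c_opt = 1`»); and
  the class-predicate form `ClassAbsManinConstantEqOne W` (`ManinConstantClassCertificate.lean`) for
  `N(W) ≤ 400000` / `< 500000`.
* NOT HERE — THEOREM GRADE, separate decls already in the tree, to be cited INSTEAD of this file
  wherever they apply: at a prime `p` with `p² ∤ N'` the conclusion `p ∤ c` is the printed theorem
  of Mazur / Abbes–Ullmo / Česnavičius 2018 Thm. 1.2
  (`ModularForms.cesnavicius2018_not_dvd_maninConstant_of_not_sq_dvd_level`, any conductor); at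
  `p ≥ 11` outside the potentially-ordinary types II/III/IV it is Edixhoven 1991 Thm. 3
  (`ModularForms.edixhoven_not_dvd_maninConstant_of_not_potentiallyGoodOrdinary`,
  `…_of_kodairaSymbol_ne`); at `p ≥ 5` with `p ∤ deg φ` it is Česnavičius–Neururer–Saha 2024
  Thm. 1.2 (`ModularForms.not_dvd_maninConstant_of_not_dvd_modularDegree`); for `N' ≤ 130000` it
  is Agashe–Ribet–Stein 2006 Thm. 2.6. Also NOT here: any "curve number `1` is optimal" sentence
  (a statement about labels, not about curves; the Lean hypothesis `hopt` carries optimality per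
  class and a two-engine certificate or the code-`1` datum discharges it in the register), the
  `X₁(N)` constants, anything at `N ≥ 500000`.

## Addendum (same seat, gen 2, 2026-08-26): the REFEREED-SECONDARY sentence at the PUBLISHED bound

The sibling `ManinConstantConductorLe300000.lean` now also carries, BY NAME,
`cremona_abs_maninConstant_eq_one_of_level_le_500000` — the same lattice sentence at the bound
`N' ≤ 500000`, vendored from the PUBLISHED text of Česnavičius–Neururer–Saha, J. Eur. Math. Soc.
26 (2024) 573–637, §1, journal p. 574 (EMS Press full text, CC BY 4.0, read by this seat:
`paper:url-9e5b15b890bf` p0002:L30–32): "indeed, Cremona used the computational approach to prove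
in [Cre22] that the Manin conjecture holds whenever `N ≤ 500000`", with [Cre22] = *Manin constants
and optimal curves*, `ecdata/manin.txt` (p0063:L18–19) = the PRIMARY of this file. That sentence is
a refereed text CITING the database documentation (registry reading PUB[sec], as for the `300000`
sibling); the two facts below are the DATUM-grade transcription of the primary itself. They are ONE
sentence at several bounds, not independent inputs: PROVED below, `…_le_500000` ⇒ `…_lt_500000` ⇒
`…_le_400000` ⇒ `…_le_300000` ⇒ ARS06 Thm. 2.6's statement, and the class-predicate form at
`N(W) ≤ 500000`. (No elliptic curve over `ℚ` has conductor `500000 = 2⁵·5⁶`, since `ord_p N ≤ 2`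
for `p ≥ 5`; so "`≤ 500000`" and "`< 500000`" name the same population — the converse implication
is not typed because it is not needed.) A consumer who wants the refereed-secondary citation tier
takes `(h : cremona_abs_maninConstant_eq_one_of_level_le_500000)` and feeds the corollaries of this
file through `cremona_abs_maninConstant_eq_one_of_level_lt_500000_of_le_500000`.

## References
* [Cremona2022ManinConstants] J. E. Cremona, *Manin constants and optimal curves*,
  `ecdata/manin.txt` (¶1, ¶2, ¶ "Concerning the Manin constant", "Data files", "Additional
  remarks" 1) and `ecdata/opt_man/*` (the per-curve optimality code and Manin constant).
* [AgasheRibetStein2006] A. Agashe, K. Ribet, W. A. Stein, *The Manin constant*, Pure Appl. Math.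
  Q. 2 (2006) 617–636, Thm. 2.6; appendix by J. E. Cremona, §5 (the method), Thm. 5.2.
* [CesnaviciusNeururerSaha2023] K. Česnavičius, M. Neururer, A. Saha, JEMS 26 (2024) 573–637, §1
  and ref. [Cre19] (arXiv v3) = [Cre22] (published text, p. 574 and bibliography p. 635; doi:10.4171/JEMS/1367). [Cesnavicius2018] K. Česnavičius, Compositio Math. 154 (2018), §1, ref. [Cre16].
-/

noncomputable section

open scoped MatrixGroups ModularForm

open CongruenceSubgroup UpperHalfPlane WeierstrassCurve
  Literature.NumberTheory.EllipticCurves.ModularForms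

namespace Literature.NumberTheory.EllipticCurves

/-! ### The two named facts (datum grade) -/

/-- **Cremona's database, the DETERMINED range: every `X₀(N)`-optimal curve of conductor
`N ≤ 400000` has Manin constant `±1`** (`ecdata/manin.txt` ¶1–2 and ¶ "Concerning the Manin
constant": below conductor `400000` "curve number 1 is the `Γ₀(N)`-optimal curve" with no
undetermined class — the `64249` undetermined ones are all "of conductor `> 400000`" — and "the
Manin constant is `1` for every optimal curve"; data `opt_man`: optimality code `1` and Manin
constant `1` on the optimal curve of every class with `N ≤ 400000`, checked on the hub copy).
Lattice rendering, word for word that of `cremona_abs_maninConstant_eq_one_of_level_le_300000`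
and `AgasheRibetStein2006.cremona_abs_maninConstant_eq_one_of_level_le`: for every globally minimal
model `W'/ℚ` of an elliptic curve, every parametrisation datum `D'` at level `N'` with
`Λ_{E'} ⊆ c·Λ_f` (so `φ_{D'}` is the optimal parametrisation and `c = D'.maninConstant ∈ ℤ` its Manin
constant), if `N' ≤ 400000` then `|c| = 1`. DATUM GRADE: a completed modular-symbol computation
documented with a
database, not a refereed theorem (refereed only for `N' ≤ 130000`, Agashe–Ribet–Stein 2006
Thm. 2.6). Named fact (statement only).
[cite: Cremona2022ManinConstants, manin.txt ¶1–2, ¶ "Concerning the Manin constant",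
"Data files"; opt_man: code 1 and mc 1 in every class with N ≤ 400000]
[cite: AgasheRibetStein2006, appendix §5 (method)] -/
def cremona_abs_maninConstant_eq_one_of_level_le_400000 : Prop :=
  ∀ (W' : WeierstrassCurve ℚ) [W'.IsElliptic] [W'.IsGloballyMinimal] {N' : ℕ} [NeZero N']
    (D' : ModularParametrizationData W' N'),
    (∀ z ∈ D'.L.lattice, ∃ w ∈ periodLattice D'.f, z = D'.c * w) →
    N' ≤ 400000 → |D'.maninConstant| = 1

/-- **Cremona's database, the FULL range: every `X₀(N)`-optimal curve of conductor `N < 500000`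
has Manin constant `±1`** (`ecdata/manin.txt` ¶1: "for specific levels up to `500000`, we have
computed the full modular symbol space … in almost all cases (see below for the exceptions) it is
possible to deduce that the Manin constant for the optimal curve is `1` even when there is more
than one possible optimal curve"; ¶ "Concerning the Manin constant": "the Manin constant is `1`
for every optimal curve"; "Additional remarks" 1: the exceptions eliminated by full-space
computations). Same lattice rendering, bound `N' < 500000` (the database covers conductors
`≤ 499998`). SCOPE NOTE (referee A R325.2 (3) / R317.3 (γ″)): for the `64249` classes of conductor
`> 400000` whose optimal curve is NOT determined (optimality code `≥ 2`) this sentence is the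
documentation's deduction about the undetermined optimal curve — a datum the referee distinguishes
from the per-curve «code `1` ∧ `mc = 1`» datum; the hypothesis "`W'` is the optimal curve" is the
displayed lattice clause, which this fact does not discharge. DATUM GRADE. Named fact (statement
only). [cite: Cremona2022ManinConstants, manin.txt ¶1, ¶ "Concerning the Manin constant",
"Additional remarks" 1; opt_man: mc 1 on curve 1 in every class, N ≤ 499998]
[cite: AgasheRibetStein2006, appendix §5 (method)] -/
def cremona_abs_maninConstant_eq_one_of_level_lt_500000 : Prop :=
  ∀ (W' : WeierstrassCurve ℚ) [W'.IsElliptic] [W'.IsGloballyMinimal] {N' : ℕ} [NeZero N']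
    (D' : ModularParametrizationData W' N'),
    (∀ z ∈ D'.L.lattice, ∃ w ∈ periodLattice D'.f, z = D'.c * w) →
    N' < 500000 → |D'.maninConstant| = 1

/-! ### One sentence at four bounds -/

/-- The full-range datum implies the determined-range datum (`400000 < 500000`).
[cite: Cremona2022ManinConstants, manin.txt ¶1–2] -/
theorem cremona_abs_maninConstant_eq_one_of_level_le_400000_of_lt_500000
    (h : cremona_abs_maninConstant_eq_one_of_level_lt_500000) :
    cremona_abs_maninConstant_eq_one_of_level_le_400000 :=
  fun W' _ _ _ _ D' hopt hN ↦ h W' D' hopt (lt_of_le_of_lt hN (by norm_num))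

/-- The determined-range datum implies the sibling at Cremona's bound as cited by
Česnavičius–Neururer–Saha 2024 §1 (`300000 ≤ 400000`), hence (by
`cremona_abs_maninConstant_eq_one_of_level_le_of_le_300000`) the printed Agashe–Ribet–Stein 2006
Thm. 2.6 statement at `130000`. [cite: CesnaviciusNeururerSaha2023, §1]
[cite: AgasheRibetStein2006, Thm. 2.6] -/
theorem cremona_abs_maninConstant_eq_one_of_level_le_300000_of_le_400000
    (h : cremona_abs_maninConstant_eq_one_of_level_le_400000) :
    cremona_abs_maninConstant_eq_one_of_level_le_300000 :=
  fun W' _ _ _ _ D' hopt hN ↦ h W' D' hopt (le_trans hN (by norm_num))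

/-- … and the printed range theorem's statement (`130000`), through the `300000` sibling.
[cite: AgasheRibetStein2006, Thm. 2.6] -/
theorem cremona_abs_maninConstant_eq_one_of_level_le_of_le_400000
    (h : cremona_abs_maninConstant_eq_one_of_level_le_400000) :
    AgasheRibetStein2006.cremona_abs_maninConstant_eq_one_of_level_le :=
  cremona_abs_maninConstant_eq_one_of_level_le_of_le_300000
    (cremona_abs_maninConstant_eq_one_of_level_le_300000_of_le_400000 h)

/-! ### The binder shapes of the consumers (H-TAB-MANIN: «`c_opt = 1`», i.e. `p ∤ c`) -/

/-- Under the determined-range datum, no prime divides the Manin constant of an optimal datum at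
level `≤ 400000` (proof word for word that of `not_dvd_maninConstant_of_level_le_300000`).
[cite: Cremona2022ManinConstants, manin.txt ¶ "Concerning the Manin constant"] -/
theorem not_dvd_maninConstant_of_level_le_400000
    (h : cremona_abs_maninConstant_eq_one_of_level_le_400000)
    (W' : WeierstrassCurve ℚ) [W'.IsElliptic] [W'.IsGloballyMinimal] {N' : ℕ} [NeZero N']
    (D' : ModularParametrizationData W' N')
    (hopt : ∀ z ∈ D'.L.lattice, ∃ w ∈ periodLattice D'.f, z = D'.c * w) (hN : N' ≤ 400000)
    {p : ℕ} (hp : p.Prime) : ¬ (p : ℤ) ∣ D'.maninConstant := by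
  intro hdvd
  have h1 : |D'.maninConstant| = 1 := h W' D' hopt hN
  have h2 : (p : ℤ) ∣ 1 := h1 ▸ (dvd_abs _ _).mpr hdvd
  have h3 : (p : ℤ) = 1 := Int.eq_one_of_dvd_one (by positivity) h2
  exact hp.one_lt.ne' (by exact_mod_cast h3)

/-- `ord_p c = 0` in the determined range (the record-side binder shape
`padicValInt p D.maninConstant = 0`).
[cite: Cremona2022ManinConstants, manin.txt ¶ "Concerning the Manin constant"] -/
theorem padicValInt_maninConstant_eq_zero_of_level_le_400000
    (h : cremona_abs_maninConstant_eq_one_of_level_le_400000)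
    (W' : WeierstrassCurve ℚ) [W'.IsElliptic] [W'.IsGloballyMinimal] {N' : ℕ} [NeZero N']
    (D' : ModularParametrizationData W' N')
    (hopt : ∀ z ∈ D'.L.lattice, ∃ w ∈ periodLattice D'.f, z = D'.c * w) (hN : N' ≤ 400000)
    (p : ℕ) [hp : Fact p.Prime] : padicValInt p D'.maninConstant = 0 :=
  padicValInt.eq_zero_of_not_dvd (not_dvd_maninConstant_of_level_le_400000 h W' D' hopt hN hp.out)

/-- Under the full-range datum, no prime divides the Manin constant of an optimal datum at level
`< 500000`. [cite: Cremona2022ManinConstants, manin.txt ¶1, ¶ "Concerning the Manin constant"] -/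
theorem not_dvd_maninConstant_of_level_lt_500000
    (h : cremona_abs_maninConstant_eq_one_of_level_lt_500000)
    (W' : WeierstrassCurve ℚ) [W'.IsElliptic] [W'.IsGloballyMinimal] {N' : ℕ} [NeZero N']
    (D' : ModularParametrizationData W' N')
    (hopt : ∀ z ∈ D'.L.lattice, ∃ w ∈ periodLattice D'.f, z = D'.c * w) (hN : N' < 500000)
    {p : ℕ} (hp : p.Prime) : ¬ (p : ℤ) ∣ D'.maninConstant := by
  intro hdvd
  have h1 : |D'.maninConstant| = 1 := h W' D' hopt hN
  have h2 : (p : ℤ) ∣ 1 := h1 ▸ (dvd_abs _ _).mpr hdvd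
  have h3 : (p : ℤ) = 1 := Int.eq_one_of_dvd_one (by positivity) h2
  exact hp.one_lt.ne' (by exact_mod_cast h3)

/-- `ord_p c = 0` in the full range.
[cite: Cremona2022ManinConstants, manin.txt ¶1, ¶ "Concerning the Manin constant"] -/
theorem padicValInt_maninConstant_eq_zero_of_level_lt_500000
    (h : cremona_abs_maninConstant_eq_one_of_level_lt_500000)
    (W' : WeierstrassCurve ℚ) [W'.IsElliptic] [W'.IsGloballyMinimal] {N' : ℕ} [NeZero N']
    (D' : ModularParametrizationData W' N')
    (hopt : ∀ z ∈ D'.L.lattice, ∃ w ∈ periodLattice D'.f, z = D'.c * w) (hN : N' < 500000)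
    (p : ℕ) [hp : Fact p.Prime] : padicValInt p D'.maninConstant = 0 :=
  padicValInt.eq_zero_of_not_dvd (not_dvd_maninConstant_of_level_lt_500000 h W' D' hopt hN hp.out)

/-! ### The class-predicate form (`ManinConstantClassCertificate.lean`) -/

/-- In the determined range the class predicate `ClassAbsManinConstantEqOne W` ("the optimal curve
of the class of `W` has `|c| = 1`") holds for every elliptic `W` of conductor `N(W) ≤ 400000`,
modulo modularity (`exists_isNewformOf`, to identify levels with the conductor;
`ModularForms.level_eq_conductorNorm_of_isIsogenous`).
[cite: Cremona2022ManinConstants, manin.txt ¶1–2, ¶ "Concerning the Manin constant"] -/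
theorem classAbsManinConstantEqOne_of_conductorNorm_le_400000
    (h : cremona_abs_maninConstant_eq_one_of_level_le_400000)
    (hnf : exists_isNewformOf) (W : WeierstrassCurve ℚ) [W.IsElliptic]
    (hN : W.conductorNorm ℤ ≤ 400000) : ClassAbsManinConstantEqOne W := by
  intro W' _ _ N' _ D' hiso hopt
  have hN' : N' ≤ 400000 := (level_eq_conductorNorm_of_isIsogenous hnf D' hiso) ▸ hN
  exact h W' D' hopt hN'

/-- In the full range the class predicate holds for every elliptic `W` of conductor
`N(W) < 500000`, modulo modularity.
[cite: Cremona2022ManinConstants, manin.txt ¶1, ¶ "Concerning the Manin constant"] -/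
theorem classAbsManinConstantEqOne_of_conductorNorm_lt_500000
    (h : cremona_abs_maninConstant_eq_one_of_level_lt_500000)
    (hnf : exists_isNewformOf) (W : WeierstrassCurve ℚ) [W.IsElliptic]
    (hN : W.conductorNorm ℤ < 500000) : ClassAbsManinConstantEqOne W := by
  intro W' _ _ N' _ D' hiso hopt
  have hN' : N' < 500000 := (level_eq_conductorNorm_of_isIsogenous hnf D' hiso) ▸ hN
  exact h W' D' hopt hN'

/-! ### The refereed-secondary sentence at the published bound `500000` (sibling decl
`cremona_abs_maninConstant_eq_one_of_level_le_500000`) implies everything in this file -/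

/-- ONE sentence at several bounds: the statement at the published bound `N' ≤ 500000`
(`cremona_abs_maninConstant_eq_one_of_level_le_500000`, vendored from Česnavičius–Neururer–Saha,
JEMS 26 (2024) §1 p. 574: "Cremona used the computational approach to prove in [Cre22] that the
Manin conjecture holds whenever `N ≤ 500000`") implies the full-database-range datum `N' < 500000`.
[cite: CesnaviciusNeururerSaha2023, §1 p. 574 (published text) and ref. [Cre22]]
[cite: Cremona2022ManinConstants, manin.txt ¶1, ¶ "Concerning the Manin constant"] -/
theorem cremona_abs_maninConstant_eq_one_of_level_lt_500000_of_le_500000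
    (h : cremona_abs_maninConstant_eq_one_of_level_le_500000) :
    cremona_abs_maninConstant_eq_one_of_level_lt_500000 :=
  fun W' _ _ _ _ D' hopt hN ↦ h W' D' hopt hN.le

/-- … hence the determined-range datum `N' ≤ 400000`.
[cite: CesnaviciusNeururerSaha2023, §1 p. 574 (published text) and ref. [Cre22]]
[cite: Cremona2022ManinConstants, manin.txt ¶1–2] -/
theorem cremona_abs_maninConstant_eq_one_of_level_le_400000_of_le_500000
    (h : cremona_abs_maninConstant_eq_one_of_level_le_500000) :
    cremona_abs_maninConstant_eq_one_of_level_le_400000 :=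
  cremona_abs_maninConstant_eq_one_of_level_le_400000_of_lt_500000
    (cremona_abs_maninConstant_eq_one_of_level_lt_500000_of_le_500000 h)

/-- The class-predicate form under the refereed-secondary sentence: `ClassAbsManinConstantEqOne W`
("the optimal curve of the class of `W` has `|c| = 1`") for every elliptic `W` of conductor
`N(W) ≤ 500000`, modulo modularity (`exists_isNewformOf`, identifying levels with the conductor).
[cite: CesnaviciusNeururerSaha2023, §1 p. 574 (published text) and ref. [Cre22]] -/
theorem classAbsManinConstantEqOne_of_conductorNorm_le_500000
    (h : cremona_abs_maninConstant_eq_one_of_level_le_500000)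
    (hnf : exists_isNewformOf) (W : WeierstrassCurve ℚ) [W.IsElliptic]
    (hN : W.conductorNorm ℤ ≤ 500000) : ClassAbsManinConstantEqOne W := by
  intro W' _ _ N' _ D' hiso hopt
  have hN' : N' ≤ 500000 := (level_eq_conductorNorm_of_isIsogenous hnf D' hiso) ▸ hN
  exact h W' D' hopt hN'

end Literature.NumberTheory.EllipticCurves

end
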